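import Summits.Parity.BatemanHorn.Theorems.SoloInformedLocalRoughValues
import Summits.Parity.BatemanHorn.Theorems.SoloInformedNonResidueClass
import Summits.Parity.BatemanHorn.Theorems.SoloInformedResidueClassMertens
import Summits.Parity.BatemanHorn.Theorems.SoloInformedQuadraticPrimeCount

/-!
# Prime-square values of a Bateman–Horn polynomial are negligible

Solo unit `solo-Parity-informed` (ideation tier, informed mode), session 14; `PLAN.md` §22.5(a), CLAIMS C64.

`eventually_card_primeSq_mul_log_le`: for one Bateman–Horn polynomial `g` of degree `≥ 2` and every
`δ > 0`, eventually `#{1 ≤ n ≤ x : g(n) = p², p prime} · log x ≤ δ x`.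

Proof (the ONE-NON-RESIDUE LOCAL SIEVE, Mathlib-only inputs): by `SoloInformedNonResidueClass` there is a
unit class `b₀ mod M` of primes `q` modulo which `g` has a non-zero NON-SQUARE value, so the classes
`B_q = {b mod q : g(b) a non-zero square}` number at most `q - ρ_g(q) - 1`; by
`SoloInformedResidueClassMertens` (Dirichlet) a finite set `S` of such primes has `∏ (1 - 1/q) ≤ η`; an `n`
with `g(n) = p²`, `p ≥ x^c`, has `|g(n)|` free of primes `< x^c` and `n mod q ∈ B_q` for `q ∈ S`, so the
local sieve `SoloInformedLocalRoughValues` counts at most `η (2 C(g) + 1) x / log x` of them; the `n` with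
`p < x^c` are at most `2 deg g · ⌈x^c⌉`.
-/

namespace Summit.Parity.BatemanHorn.Theorems

open Finset Filter Polynomial
open scoped Topology Classical
open Literature.NumberTheory.Sieve (polyRootCountMod IsBatemanHornSystem batemanHornConst primesProdBelow
  coprime_primesProdBelow_iff polyRootCountMod_single)

/-- Congruent arguments give congruent values (cast to `ZMod q`). -/
theorem intCast_eval_eq_of_dvd_sub {g : ℤ[X]} {q : ℕ} {a b : ℤ} (h : (q : ℤ) ∣ a - b) :
    ((g.eval a : ℤ) : ZMod q) = ((g.eval b : ℤ) : ZMod q) := by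
  rw [ZMod.intCast_eq_intCast_iff_dvd_sub]
  exact dvd_sub_comm.mp (h.trans (sub_dvd_eval_sub a b g))

/-- **One missing class.** If `g(t₀)` is a non-square modulo the prime `q`, then the residues `b mod q` with
`g(b)` a non-zero square number at most `q - ρ_g(q) - 1`. -/
theorem card_squareClasses_add_le {g : ℤ[X]} {q : ℕ} (hq : q.Prime) {t₀ : ℤ}
    (ht : ¬ IsSquare ((g.eval t₀ : ℤ) : ZMod q)) :
    #((range q).filter fun b : ℕ =>
        ¬ (q : ℤ) ∣ g.eval (b : ℤ) ∧ IsSquare ((g.eval (b : ℤ) : ℤ) : ZMod q))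
      + 1 + polyRootCountMod ![g] q ≤ q := by
  -- the witness class `b₀ = t₀ mod q` (no instances on `ZMod q` are introduced, on purpose)
  have hq0 : (0 : ℤ) < q := by exact_mod_cast hq.pos
  obtain ⟨b₀, hb₀⟩ : ∃ b₀ : ℕ, (b₀ : ℤ) = t₀ % q :=
    ⟨(t₀ % q).toNat, Int.toNat_of_nonneg (Int.emod_nonneg _ hq0.ne')⟩
  have hb₀q : b₀ < q := by
    have := Int.emod_lt_of_pos t₀ hq0
    omega
  have hdv : (q : ℤ) ∣ t₀ - b₀ := ⟨t₀ / q, by rw [hb₀, Int.emod_def]; ring⟩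
  have hgb₀ : ((g.eval (b₀ : ℤ) : ℤ) : ZMod q) = ((g.eval t₀ : ℤ) : ZMod q) :=
    intCast_eval_eq_of_dvd_sub (dvd_sub_comm.mp hdv)
  have hb₀ns : ¬ IsSquare ((g.eval (b₀ : ℤ) : ℤ) : ZMod q) := by rwa [hgb₀]
  have hb₀nd : ¬ (q : ℤ) ∣ g.eval (b₀ : ℤ) := by
    intro h
    apply hb₀ns
    rw [(ZMod.intCast_zmod_eq_zero_iff_dvd _ q).mpr h]
    exact ⟨0, (mul_zero _).symm⟩
  have h1 : #((range q).filter fun b : ℕ => (q : ℤ) ∣ g.eval (b : ℤ))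
      + #((range q).filter fun b : ℕ => ¬ (q : ℤ) ∣ g.eval (b : ℤ)) = q := by
    rw [card_filter_add_card_filter_not, card_range]
  have h2 : #(((range q).filter fun b : ℕ => ¬ (q : ℤ) ∣ g.eval (b : ℤ)).filter
        fun b : ℕ => IsSquare ((g.eval (b : ℤ) : ℤ) : ZMod q))
      + #(((range q).filter fun b : ℕ => ¬ (q : ℤ) ∣ g.eval (b : ℤ)).filter
        fun b : ℕ => ¬ IsSquare ((g.eval (b : ℤ) : ℤ) : ZMod q))
      = #((range q).filter fun b : ℕ => ¬ (q : ℤ) ∣ g.eval (b : ℤ)) :=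
    card_filter_add_card_filter_not _
  have h3 : 1 ≤ #(((range q).filter fun b : ℕ => ¬ (q : ℤ) ∣ g.eval (b : ℤ)).filter
        fun b : ℕ => ¬ IsSquare ((g.eval (b : ℤ) : ℤ) : ZMod q)) := by
    refine Nat.one_le_iff_ne_zero.mpr (card_ne_zero.mpr ⟨b₀, ?_⟩)
    simp only [mem_filter, mem_range]
    exact ⟨⟨hb₀q, hb₀nd⟩, hb₀ns⟩
  have h4 : #((range q).filter fun b : ℕ =>
        ¬ (q : ℤ) ∣ g.eval (b : ℤ) ∧ IsSquare ((g.eval (b : ℤ) : ℤ) : ZMod q))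
      = #(((range q).filter fun b : ℕ => ¬ (q : ℤ) ∣ g.eval (b : ℤ)).filter
        fun b : ℕ => IsSquare ((g.eval (b : ℤ) : ℤ) : ZMod q)) := by
    rw [filter_filter]
  rw [polyRootCountMod_single, h4]
  omega

/-- **Prime-square values are negligible:** for a Bateman–Horn polynomial `g` of degree `≥ 2` and `δ > 0`,
eventually `#{1 ≤ n ≤ x : g(n) = p² with p prime} · log x ≤ δ x`. -/
theorem eventually_card_primeSq_mul_log_le {g : ℤ[X]} (hg : IsBatemanHornSystem ![g])
    (hdeg : 2 ≤ g.natDegree) {δ : ℝ} (hδ : 0 < δ) :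
    ∀ᶠ x : ℕ in atTop,
      (#((Icc 1 x).filter fun n : ℕ => ∃ p : ℕ, p.Prime ∧ g.eval (n : ℤ) = (p : ℤ) ^ 2) : ℝ)
        * Real.log x ≤ δ * x := by
  have hirr : Irreducible g := by simpa using hg.irreducible 0
  have hdeg0 : 0 < g.natDegree := by omega
  obtain ⟨Cg, hCgdef⟩ : ∃ C' : ℝ, C' = batemanHornConst ![g] := ⟨_, rfl⟩
  have hCg : 0 < Cg := by rw [hCgdef]; exact hg.hasBatemanHornConst_holds.2
  -- a class of primes modulo which `g` has a non-square value (C61), a finite set of them (C62)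
  obtain ⟨t₀, -, M, hM, b₀, hb₀, hns⟩ := exists_nonsquare_value_unitClass hirr hdeg
  haveI : NeZero M := ⟨hM.ne'⟩
  obtain ⟨η, hηdef⟩ : ∃ η : ℝ, η = δ / (2 * (2 * Cg + 1)) := ⟨_, rfl⟩
  have hη0 : 0 < η := by rw [hηdef]; positivity
  obtain ⟨S, hS, hprod⟩ := exists_finset_prime_residueClass_prod_le hb₀ 0 hη0
  have hSp : ∀ q ∈ S, q.Prime := fun q hq => (hS q hq).1
  have hSns : ∀ q ∈ S, ¬ IsSquare ((g.eval t₀ : ℤ) : ZMod q) := fun q hq =>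
    hns q (hS q hq).1 (hS q hq).2.1
  -- the square classes `B_q`
  set B : ℕ → Finset ℕ := fun q => (range q).filter fun b : ℕ =>
    ¬ (q : ℤ) ∣ g.eval (b : ℤ) ∧ IsSquare ((g.eval (b : ℤ) : ℤ) : ZMod q) with hBdef
  have hB : ∀ q ∈ S, ∀ b ∈ B q, ¬ (q : ℤ) ∣ g.eval (b : ℤ) := by
    intro q _ b hb
    simp only [hBdef, mem_filter] at hb
    exact hb.2.1
  -- the local sieve (C63)
  obtain ⟨c, hc0, hc1, hT⟩ := exists_level_eventually_card_rough_residues_le hg hdeg hSp B hB one_pos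
  have hρlt : ∀ q ∈ S, polyRootCountMod ![g] q < q := fun q hq =>
    hg.hasNoFixedPrimeDivisor q (hSp q hq)
  have hβ : ∏ q ∈ S, (#(B q) : ℝ) / (q - polyRootCountMod ![g] q) ≤ η := by
    refine le_trans (prod_le_prod (fun q hq => div_nonneg (Nat.cast_nonneg _)
      (sub_nonneg.mpr (by exact_mod_cast (hρlt q hq).le))) fun q hq => ?_) hprod
    have hcnt : #(B q) + 1 + polyRootCountMod ![g] q ≤ q :=
      card_squareClasses_add_le (hSp q hq) (hSns q hq)
    have hcnt' : (#(B q) : ℝ) + 1 + polyRootCountMod ![g] q ≤ q := by exact_mod_cast hcnt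
    have hq0 : (0 : ℝ) < q := by exact_mod_cast (hSp q hq).pos
    have hqρ : (0 : ℝ) < q - polyRootCountMod ![g] q := sub_pos.mpr (by exact_mod_cast hρlt q hq)
    rw [div_le_iff₀ hqρ]
    have hρq : (0 : ℝ) ≤ polyRootCountMod ![g] q / q := by positivity
    have e : (1 - 1 / (q : ℝ)) * (q - polyRootCountMod ![g] q)
        = q - polyRootCountMod ![g] q - 1 + polyRootCountMod ![g] q / q := by
      field_simp
      ring
    rw [e]
    linarith
  -- eventual facts
  have E2 : ∀ᶠ x : ℕ in atTop, ∀ q ∈ S, (q : ℝ) < (x : ℝ) ^ c := by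
    have ht : Tendsto (fun x : ℕ => (x : ℝ) ^ c) atTop atTop :=
      (tendsto_rpow_atTop hc0).comp tendsto_natCast_atTop_atTop
    exact (eventually_all_finset S).mpr fun q _ => ht.eventually (eventually_gt_atTop (q : ℝ))
  have E3 : ∀ᶠ x : ℕ in atTop,
      (2 * g.natDegree : ℝ) * (⌈(x : ℝ) ^ c⌉₊ : ℝ) * Real.log x ≤ δ / 2 * x := by
    have h1c : 0 < 1 - c := by linarith
    obtain ⟨κ, hκdef⟩ : ∃ κ : ℝ, κ = δ / (8 * g.natDegree) := ⟨_, rfl⟩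
    have hd0 : (0 : ℝ) < g.natDegree := by exact_mod_cast hdeg0
    have hκ0 : 0 < κ := by rw [hκdef]; positivity
    have hlo := ((isLittleO_log_rpow_atTop h1c).comp_tendsto tendsto_natCast_atTop_atTop).def hκ0
    filter_upwards [hlo, eventually_ge_atTop 1] with x hx hx1
    simp only [Function.comp_apply, Real.norm_eq_abs] at hx
    have hx0 : (0 : ℝ) < x := by exact_mod_cast hx1
    rw [abs_of_nonneg (Real.log_nonneg (by exact_mod_cast hx1)), abs_of_nonneg (by positivity)] at hx
    have hxc1 : (1 : ℝ) ≤ (x : ℝ) ^ c := Real.one_le_rpow (by exact_mod_cast hx1) hc0.le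
    have hceil : (⌈(x : ℝ) ^ c⌉₊ : ℝ) ≤ 2 * (x : ℝ) ^ c := by
      have := Nat.ceil_lt_add_one (show (0 : ℝ) ≤ (x : ℝ) ^ c by positivity)
      linarith
    have hxx : (x : ℝ) ^ c * (x : ℝ) ^ (1 - c) = x := by
      rw [← Real.rpow_add hx0]
      norm_num
    calc (2 * g.natDegree : ℝ) * (⌈(x : ℝ) ^ c⌉₊ : ℝ) * Real.log x
        ≤ (2 * g.natDegree : ℝ) * (2 * (x : ℝ) ^ c) * (κ * (x : ℝ) ^ (1 - c)) := by gcongr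
      _ = 4 * g.natDegree * κ * ((x : ℝ) ^ c * (x : ℝ) ^ (1 - c)) := by ring
      _ = δ / 2 * x := by
          rw [hxx, hκdef]
          field_simp
          ring
  filter_upwards [hT, E2, E3, eventually_ge_atTop 2] with x h1 h2 h3 hx2
  have hx0 : (0 : ℝ) < x := by exact_mod_cast (by omega : 0 < x)
  have hlog : 0 < Real.log x := Real.log_pos (by exact_mod_cast (by omega : 1 < x))
  -- the prime-square set splits into rough values in square classes and small-prime squares
  set PSQ := (Icc 1 x).filter (fun n : ℕ => ∃ p : ℕ, p.Prime ∧ g.eval (n : ℤ) = (p : ℤ) ^ 2)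
    with hPSQ
  set T := (Icc 1 x).filter (fun n : ℕ =>
    ((g.eval (n : ℤ)).natAbs).Coprime (primesProdBelow ((x : ℝ) ^ c)) ∧ ∀ q ∈ S, n % q ∈ B q)
    with hTdef
  set LOW := (range ⌈(x : ℝ) ^ c⌉₊).biUnion (fun p : ℕ =>
    (Icc 1 x).filter fun n : ℕ => (g.eval (n : ℤ)).natAbs = p ^ 2) with hLOW
  have hsub : PSQ ⊆ T ∪ LOW := by
    intro n hn
    rw [hPSQ, mem_filter] at hn
    obtain ⟨hnI, p, hp, hgn⟩ := hn
    have hgabs : (g.eval (n : ℤ)).natAbs = p ^ 2 := by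
      rw [hgn, Int.natAbs_pow, Int.natAbs_natCast]
    rw [mem_union]
    by_cases hpx : (p : ℝ) < (x : ℝ) ^ c
    · exact Or.inr (mem_biUnion.mpr ⟨p, mem_range.mpr (Nat.lt_ceil.mpr hpx),
        mem_filter.mpr ⟨hnI, hgabs⟩⟩)
    · rw [not_lt] at hpx
      refine Or.inl (mem_filter.mpr ⟨hnI, ?_, fun q hq => ?_⟩)
      · rw [coprime_primesProdBelow_iff, hgabs]
        intro q hq hdvd
        rw [Nat.mem_primesBelow] at hq
        have hqp : q = p := (Nat.prime_dvd_prime_iff_eq hq.2 hp).mp (hq.2.dvd_of_dvd_pow hdvd)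
        have hlt : (q : ℝ) < (x : ℝ) ^ c := Nat.lt_ceil.mp hq.1
        rw [hqp] at hlt
        linarith
      · have hqP : q.Prime := hSp q hq
        have hqltp : q < p := by exact_mod_cast (h2 q hq).trans_le hpx
        have hmod : (q : ℤ) ∣ (n : ℤ) - ((n % q : ℕ) : ℤ) := by
          refine ⟨((n / q : ℕ) : ℤ), ?_⟩
          have h := Nat.div_add_mod n q
          have h' : (n : ℤ) = (q : ℤ) * ((n / q : ℕ) : ℤ) + ((n % q : ℕ) : ℤ) := by
            exact_mod_cast h.symm
          linear_combination h'
        have hval : ((g.eval ((n % q : ℕ) : ℤ) : ℤ) : ZMod q) = ((g.eval (n : ℤ) : ℤ) : ZMod q) :=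
          intCast_eval_eq_of_dvd_sub (dvd_sub_comm.mp hmod)
        simp only [hBdef, mem_filter, mem_range]
        refine ⟨Nat.mod_lt _ hqP.pos, fun hdvd => ?_, ?_⟩
        · have h1' : (q : ℤ) ∣ g.eval (n : ℤ) :=
            (dvd_sub_left hdvd).mp (hmod.trans (sub_dvd_eval_sub _ _ g))
          rw [hgn, ← Nat.cast_pow, Int.natCast_dvd_natCast] at h1'
          have := (Nat.prime_dvd_prime_iff_eq hqP hp).mp (hqP.dvd_of_dvd_pow h1')
          omega
        · rw [hval, hgn]
          push_cast
          exact ⟨(p : ZMod q), sq _⟩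
  -- counting
  have hLOWcard : #LOW ≤ ⌈(x : ℝ) ^ c⌉₊ * (2 * g.natDegree) := by
    calc #LOW ≤ ∑ p ∈ range ⌈(x : ℝ) ^ c⌉₊,
          #((Icc 1 x).filter fun n : ℕ => (g.eval (n : ℤ)).natAbs = p ^ 2) := card_biUnion_le
      _ ≤ ∑ p ∈ range ⌈(x : ℝ) ^ c⌉₊, 2 * g.natDegree :=
          sum_le_sum fun p _ => card_filter_natAbs_eval_eq_le g hdeg0 _ _
      _ = ⌈(x : ℝ) ^ c⌉₊ * (2 * g.natDegree) := by rw [sum_const, card_range, smul_eq_mul]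
  have hcard : (#PSQ : ℝ) ≤ #T + (⌈(x : ℝ) ^ c⌉₊ : ℝ) * (2 * g.natDegree) := by
    have h := (card_le_card hsub).trans ((card_union_le _ _).trans (Nat.add_le_add_left hLOWcard _))
    exact_mod_cast h
  rw [← hCgdef] at h1
  have hT' : (#T : ℝ) * Real.log x ≤ η * (2 * Cg + 1) * x := by
    have hpos : 0 ≤ (2 * Cg + 1) * x / Real.log x := by positivity
    have h1'' := h1.trans (mul_le_mul_of_nonneg_right hβ hpos)
    calc (#T : ℝ) * Real.log x ≤ (η * ((2 * Cg + 1) * x / Real.log x)) * Real.log x := by gcongr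
      _ = η * (2 * Cg + 1) * x := by field_simp
  have hηC : η * (2 * Cg + 1) = δ / 2 := by
    rw [hηdef]
    field_simp
  calc (#PSQ : ℝ) * Real.log x ≤ (#T + (⌈(x : ℝ) ^ c⌉₊ : ℝ) * (2 * g.natDegree)) * Real.log x := by
        gcongr
    _ = #T * Real.log x + (2 * g.natDegree : ℝ) * (⌈(x : ℝ) ^ c⌉₊ : ℝ) * Real.log x := by ring
    _ ≤ η * (2 * Cg + 1) * x + δ / 2 * x := add_le_add hT' h3
    _ = δ * x := by rw [hηC]; ring

end Summit.Parity.BatemanHorn.Theorems
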